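import Literature.AnabelianGeometry.EtaleTheta.SettingModelTateDeckTwist
import Literature.AnabelianGeometry.EtaleTheta.SettingModelTateProp15iiiInnerRigidity
import Literature.AnabelianGeometry.EtaleTheta.SettingModelTateProp15Quot
import HarnessLib

/-!
# The STAGE-2 («Tate shear») model of [EtTh] §1 at `(i, j) = (2, 2)`: the `log(Ü)`-TWISTED class satisfies the typed
# Prop. 1.5 (iii) AND the deck-sign clause — a JOINT instance (proof-only; non-vacuity)

S. Mochizuki, *The étale theta function and its Frobenioid-theoretic manifestations*, Publ. RIMS **45** (2009) [EtTh], §1,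
Prop. 1.5 (iii), PRIMS PDF p. 23 (printed 249) «on which `a ∈ Z` acts as follows: `η̈^Θ ↦ η̈^Θ − 2a·log(Ü) − (a²/2)·log(q_X)
+ log(O^×_K̈)`»; Prop. 1.4 (ii) p. 22 («`Θ̈(−Ü) = −Θ̈(Ü)`») [cite: MochizukiEtTh2009, Prop 1.5 (iii) p.23].
abc-iut cell, layer L2, seat abc-iut-L2-t12 (gen 10); offer (T2) «JOINT-P15III-DECK@(2,2)» (L2 ROWS #144/#145, sequel to
this seat's `SettingModelTateDeckTwist`, p500679).  PROOF-ONLY: no definition, no instance, no `Prop` fact; everything BY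
NAME — this seat's gen-6 `conj_deckGen_zClassYddχq_gen` (`SettingModelTateProp15iiiInnerRigidity`: `σ₀·x′ =
x′·log(Ü)^{−2}·κ̈(q̈)^{−i}`, every `i`), abc-iut-L2-t6's `conj_deckGen_logUdd` (`σ₀·log(Ü) = log(Ü)·κ̈(q̈)·κ̈(1)`, `j = 2`),
`unitLaw_GtpY_zClassYddχq` / `unitLaw_GtpY_logUdd`, `res_zClassYddχq_eq_logTheta`, `kumYdd_toKddHat_ofSection_modelχq`,
abc-iut-w5-d140/L2-t6's `prop15iiQuot_ofSection_modelχq` with the junction `Prop15iiQuot.logUdd_mem_Fdd1`, and this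
lineage's generator reduction `KummerCore.prop15iii_etaleThetaDataOfClass_ofSection_of_generator` (gen 5).

THE RECORD: at `modelχq p i j` the typed Prop. 1.5 (iii) for the datum of the `z`-class `η̈♯ = etaDdχq` holds IFF
`(i, j) = (1, 2)` (`prop15iii_etaDdχq_iff`), and there the deck-sign clause (P14ii-cl) FAILS (p491944) — «no joint instance».
THIS FILE (numbers, not a side): at `(i, j) = (2, 2)` the TWISTED class `η̈♯″ := etaDdχq · infl(log Ü)` with lift
`x″ := zClassYddχq · log(Ü)` has the printed display `σ₀·x″ = x″ · log(Ü)^{−2} · κ̈(q̈)^{−1}` (the shear's `κ̈(q̈)^{−2}`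
and `log(Ü)`'s `κ̈(q̈)^{+1}` combine), `res(x″) = log(Θ)`, unit-moves by `1`, `−1` under `Π^tp_Y`; hence
* **`prop15iii_etaDdTwistχq_two_two`** — `Prop15iii` HOLDS at `modelχq p 2 2` for the étale-theta datum of `η̈♯″` over
  the section Kummer datum of ANY Galois section `s`;
* **`hdeck_etaDdTwistχq_two_two`** — the SAME datum satisfies the deck-sign clause (from p500679);
* **`exists_prop15iii_and_hdeck_modelχq_two_two`** — JOINT ∃-form: an étale-theta datum at a stage-2 model satisfying
  the typed Prop. 1.5 (iii) `Z`-law AND (P14ii-cl) — the first such in the tree.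
NOT CLAIMED: the inversion clause (`InvClauses`) for `η̈♯″` (the inversion of record would have to be re-centred), Prop. 1.5
(iii) for the twisted class at `(i, j) ≠ (2, 2)`, anything about the commutator-axis cusp (G-L2t12g9-1 proper).
HONEST FRAMING: SEMI-SYNTHETIC model — consistency / non-vacuity evidence for the typed interface ONLY; [EtTh] is refereed
and nothing of it is disputed or asserted; typed ≠ proved; inhabited-at-a-model ≠ proved; no side taken on [IUTchIII] Cor. 3.12.
-/

noncomputable section

namespace Literature.AnabelianGeometry.EtaleTheta.SettingModel

open Literature.AnabelianGeometry.SemiGraphs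

variable (p : ℕ) [Fact p.Prime]

/-- Commutative-group bookkeeping for the `σ₀`-display of the twisted lift. [folklore] -/
private theorem twist_display_algebra {H : Type*} [CommGroup H] (z L Q : H) :
    z * L ^ (-(2 : ℤ)) * Q ^ (-(2 : ℤ)) * (L * Q * 1) = z * L * L ^ (-(2 : ℤ)) * Q ^ (-(1 : ℤ)) * 1 := by
  apply Additive.ofMul.injective
  simp only [ofMul_mul, ofMul_zpow, ofMul_one]
  abel

/-- Commutative-group bookkeeping for the unit-moves of the twisted lift. [folklore] -/
private theorem twist_unit_algebra {H : Type*} [CommGroup H] (z L u₁ u₂ : H) :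
    z * u₁ * (L * u₂) = z * L * (u₁ * u₂) := by
  apply Additive.ofMul.injective
  simp only [ofMul_mul]
  abel

section OfSection

variable (s : GQp p →* (ThetaSetting.modelχq p 2 2 even_two).PiTemp) (hs : Continuous s)
  (hsec : ∀ σ : GQp p, (ThetaSetting.modelχq p 2 2 even_two).aug (s σ) = σ)
  (hsY : (ThetaSetting.modelχq p 2 2 even_two).GK.map s ≤ (ThetaSetting.modelχq p 2 2 even_two).GtpY)
  (hsYdd : (ThetaSetting.modelχq p 2 2 even_two).GKdd.map s ≤ (ThetaSetting.modelχq p 2 2 even_two).GtpYdd)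

include s hs hsec hsY hsYdd in
/-- **`res(log Ü) = 1` on `Δ_Θ`** at the stage-2 model (`log(Ü) ∈ F̈¹`, via the Prop. 1.5 (ii)-Quot junction through
the section datum of `s`). [cite: MochizukiEtTh2009, Prop 1.5 (ii) p.23] -/
theorem res_deltaTheta_logUdd_kummerCoreχq_two_two (hC : (ThetaSetting.modelχq p 2 2 even_two).Compat) :
    ContH1.res (MonoidHom.id (ThetaSetting.modelχq p 2 2 even_two).GtpTheta) (ThetaSetting.modelχq p 2 2 even_two).DeltaTheta
        (hC.deltaTheta_le_DtpYddTheta.trans (Subgroup.map_mono inf_le_left)) (kummerCoreχq p 2 2 even_two).logUdd = 1 :=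
  MonoidHom.mem_ker.mp (prop15iiQuot_ofSection_modelχq s hs hsec hsY hsYdd hC).logUdd_mem_Fdd1

/-- **[EtTh] Prop. 1.5 (iii) HOLDS at `modelχq p 2 2` for the `log(Ü)`-TWISTED datum** `η̈♯″ = etaDdχq · infl(log Ü)` over
the section Kummer datum of any Galois section `s`: lift `x″ = zClassYddχq · log(Ü)` (`res = log(Θ)`), deck display
`σ₀·x″ = x″·log(Ü)^{−2}·κ̈(q̈)^{−1}` (the `i = 2` shear `κ̈(q̈)^{−2}` of `conj_deckGen_zClassYddχq_gen` times the `κ̈(q̈)^{+1}` of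
`conj_deckGen_logUdd`), `Π^tp_Y` unit-moves (units `1 · u`), all through this lineage's generator reduction.
[cite: MochizukiEtTh2009, Prop 1.5 (iii) p.23] -/
theorem prop15iii_etaDdTwistχq_two_two (hC : (ThetaSetting.modelχq p 2 2 even_two).Compat) :
    ThetaSetting.Prop15iii
      (((kummerCoreχq p 2 2 even_two).toKummerDataOfSection s hs hsec hsY hsYdd).etaleThetaDataOfClass
        (etaDdχq p 2 2 even_two *
          (ThetaSetting.modelχq p 2 2 even_two).inflTheta (ThetaSetting.modelχq p 2 2 even_two).GtpYdd
            (kummerCoreχq p 2 2 even_two).logUdd)) hC := by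
  haveI := hC.GtpYddTheta_normal
  have e := kumYdd_toKddHat_ofSection_modelχq p 2 2 even_two s hs hsec hsY hsYdd
  refine (kummerCoreχq p 2 2 even_two).prop15iii_etaleThetaDataOfClass_ofSection_of_generator s hs hsec hsY hsYdd hC
    _ (zClassYddχq p 2 2 even_two * (kummerCoreχq p 2 2 even_two).logUdd) ?_ ?_
    (toZ_inl_gfpOf_a p 2 2 even_two) ?_ (unitLaw_GtpY_logUdd p 2 2 even_two hC s hs hsec hsY hsYdd) ?_ ?_
  · -- `infl(x″) = η̈♯″`
    rw [map_mul, etaDdχq_def]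
  · -- `res(x″) = log(Θ)`
    refine ((ContH1.res _ _ _).map_mul _ _).trans ?_
    rw [res_zClassYddχq_eq_logTheta p 2 2 even_two hC,
      res_deltaTheta_logUdd_kummerCoreχq_two_two p s hs hsec hsY hsYdd hC, mul_one]
  · -- `hL₀`
    refine ⟨1, (ThetaSetting.modelχq p 2 2 even_two).unitsOKdd.one_mem, ?_⟩
    rw [e, e]
    exact conj_deckGen_logUdd p 2 hC
  · -- `hx₀`: the twisted display
    refine ⟨1, (ThetaSetting.modelχq p 2 2 even_two).unitsOKdd.one_mem, ?_⟩
    rw [e, e, map_mul, conj_deckGen_zClassYddχq_gen p 2 2 even_two hC, conj_deckGen_logUdd p 2 hC, map_one, map_one]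
    exact twist_display_algebra _ _ _
  · -- `hxY`: unit-moves of `x″` under `Π^tp_Y`
    intro y hy
    obtain ⟨u₁, hu₁, h₁⟩ := unitLaw_GtpY_zClassYddχq p 2 2 even_two hC s hs hsec hsY hsYdd y hy
    obtain ⟨u₂, hu₂, h₂⟩ := unitLaw_GtpY_logUdd p 2 2 even_two hC s hs hsec hsY hsYdd y hy
    refine ⟨u₁ * u₂, (ThetaSetting.modelχq p 2 2 even_two).unitsOKdd.mul_mem hu₁ hu₂, ?_⟩
    rw [map_mul, h₁, h₂, map_mul, map_mul]
    exact twist_unit_algebra _ _ _ _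

/-- **… and the SAME datum satisfies the deck-sign clause (P14ii-cl)** (this seat's p500679, with the section datum's
Kummer classes identified with the core's). [cite: MochizukiEtTh2009, Prop 1.4 (ii) p.22] -/
theorem hdeck_etaDdTwistχq_two_two (hC : (ThetaSetting.modelχq p 2 2 even_two).Compat) :
    haveI := hC.GtpYdd_normal
    let E := ((kummerCoreχq p 2 2 even_two).toKummerDataOfSection s hs hsec hsY hsYdd).etaleThetaDataOfClass
      (etaDdχq p 2 2 even_two *
        (ThetaSetting.modelχq p 2 2 even_two).inflTheta (ThetaSetting.modelχq p 2 2 even_two).GtpYdd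
          (kummerCoreχq p 2 2 even_two).logUdd)
    ∀ ε : PiTpχq p 2 2, ε ∈ (ThetaSetting.modelχq p 2 2 even_two).GtpY → ε ∉ (ThetaSetting.modelχq p 2 2 even_two).GtpYdd →
      ContH1.conj (ThetaSetting.modelχq p 2 2 even_two).toTheta (ThetaSetting.modelχq p 2 2 even_two).DeltaTheta ε E.etaDd =
        (ThetaSetting.modelχq p 2 2 even_two).inflTheta (ThetaSetting.modelχq p 2 2 even_two).GtpYdd
          (E.kumYdd (E.toKddHat (-1))) * E.etaDd := by
  haveI := hC.GtpYdd_normal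
  intro E ε hε hε'
  change ContH1.conj _ _ ε (etaDdχq p 2 2 even_two * _) =
    (ThetaSetting.modelχq p 2 2 even_two).inflTheta (ThetaSetting.modelχq p 2 2 even_two).GtpYdd
      (((kummerCoreχq p 2 2 even_two).toKummerDataOfSection s hs hsec hsY hsYdd).kumYdd
        (((kummerCoreχq p 2 2 even_two).toKummerDataOfSection s hs hsec hsY hsYdd).toKddHat (-1))) * _
  rw [kumYdd_toKddHat_ofSection_modelχq p 2 2 even_two s hs hsec hsY hsYdd]
  exact conj_etaDdTwistχq_of_not_mem_GtpYdd p 2 2 even_two hC hε hε'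

end OfSection

/-- **JOINT INSTANCE (census form)**: at `modelχq p 2 2` (every `p`, every `Compat` witness) there is an étale-theta datum
— the `log(Ü)`-twist `η̈♯ · infl(log Ü)` over the `inr`-section Kummer datum — satisfying BOTH the typed Prop. 1.5 (iii)
`Z`-law AND the class-level deck-sign clause (P14ii-cl).  (Record for the UNtwisted class: Prop15iii ⟺ `(i, j) = (1, 2)`,
`prop15iii_etaDdχq_iff`, where (P14ii-cl) fails, p491944.) [cite: MochizukiEtTh2009, Prop 1.5 (iii) p.23] -/
theorem exists_prop15iii_and_hdeck_modelχq_two_two (hC : (ThetaSetting.modelχq p 2 2 even_two).Compat) :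
    haveI := hC.GtpYdd_normal
    ∃ E : (ThetaSetting.modelχq p 2 2 even_two).EtaleThetaData,
      E.etaDd = etaDdχq p 2 2 even_two *
        (ThetaSetting.modelχq p 2 2 even_two).inflTheta (ThetaSetting.modelχq p 2 2 even_two).GtpYdd
          (kummerCoreχq p 2 2 even_two).logUdd ∧
      ThetaSetting.Prop15iii E hC ∧
      ∀ ε : PiTpχq p 2 2, ε ∈ (ThetaSetting.modelχq p 2 2 even_two).GtpY → ε ∉ (ThetaSetting.modelχq p 2 2 even_two).GtpYdd →
        ContH1.conj (ThetaSetting.modelχq p 2 2 even_two).toTheta (ThetaSetting.modelχq p 2 2 even_two).DeltaTheta ε E.etaDd =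
          (ThetaSetting.modelχq p 2 2 even_two).inflTheta (ThetaSetting.modelχq p 2 2 even_two).GtpYdd
            (E.kumYdd (E.toKddHat (-1))) * E.etaDd :=
  ⟨_, rfl,
    prop15iii_etaDdTwistχq_two_two p SemidirectProduct.inr (continuous_inrχq p 2 2) (fun _ => rfl)
      (map_inr_GK_le_GtpY_modelχq' p 2 2 even_two) (map_inr_GKdd_le_GtpYdd_modelχq' p 2 2 even_two) hC,
    hdeck_etaDdTwistχq_two_two p SemidirectProduct.inr (continuous_inrχq p 2 2) (fun _ => rfl)
      (map_inr_GK_le_GtpY_modelχq' p 2 2 even_two) (map_inr_GKdd_le_GtpYdd_modelχq' p 2 2 even_two) hC⟩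

/-- **Root-level census form**: within the stage-2 family there is a theta SETTING of record (`modelχq p 2 2`, an
`IsEtThOrigin` setting with `Compat`) carrying an étale-theta datum that satisfies Prop. 1.5 (iii) and (P14ii-cl) jointly.
[cite: MochizukiEtTh2009, Prop 1.5 (iii) p.23] -/
theorem _root_.Literature.AnabelianGeometry.EtaleTheta.ThetaSetting.exists_isEtThOrigin_prop15iii_and_hdeck_stageTwo :
    ∃ (D : ThetaSetting p) (hC : D.Compat) (E : D.EtaleThetaData), D = ThetaSetting.modelχq p 2 2 even_two ∧
      D.IsEtThOrigin ∧ ThetaSetting.Prop15iii E hC ∧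
      haveI := hC.GtpYdd_normal
      ∀ ε : D.PiTemp, ε ∈ D.GtpY → ε ∉ D.GtpYdd →
        ContH1.conj D.toTheta D.DeltaTheta ε E.etaDd = D.inflTheta D.GtpYdd (E.kumYdd (E.toKddHat (-1))) * E.etaDd := by
  obtain ⟨E, -, h15, hdeck⟩ := exists_prop15iii_and_hdeck_modelχq_two_two p (ThetaSetting.modelχq_sec2Hyps p 2 2 even_two).compat
  exact ⟨_, _, E, rfl, ThetaSetting.modelχq_isEtThOrigin p 2 2 even_two, h15, hdeck⟩

end Literature.AnabelianGeometry.EtaleTheta.SettingModel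

end
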